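import Summits.AtomisticToContinuum.Crystallization.Theorems.ExcessDecayLiouvillePhononStabilityCertChartId
import Summits.AtomisticToContinuum.Crystallization.Theorems.ExcessDecayLiouvillePhononStabilityCertLinks
import Summits.AtomisticToContinuum.Crystallization.Theorems.ExcessDecayLiouvillePhononStabilityCertDual
import Summits.AtomisticToContinuum.Crystallization.Theorems.ExcessDecayLiouvillePhononStabilityCertWindow

/-!
# Near-certificate layer VIII: algebraic elimination of the dual metric `Ĥ`

Support file for crux `PhononStability` (stmt-AtomisticToContinuum-9333), line `contragredient-window-collapse`
(lead c2).  The metric form `Y_c = Σ_k ‖B Δ‖²` is the pair form of `Ĥ = (⟪B dgenᵢ, B dgenⱼ⟫)` and `Ĝ Ĥ = 1`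
(`…CertLinks`).  Around a symmetric cell centre `G_c` with symmetric two-sided inverse `H_c` and strain
deviation `X = Ĝ − G_c`:

* `Ĥ = (H_c − H_c X H_c) + (Ĥ − H_c) Ĝ (Ĥ − H_c)` (exact identity of matrices);
* for every coefficient vector `x`: `0 ≤ xᵀ (Ĥ − H_c) Ĝ (Ĥ − H_c) x ≤ (200/189)² · zᵀ M₀⁻¹ z` with `z = (X H_c) x`
  (positivity of `Ĝ` as a Gram matrix, `Ĥ − H_c = −Ĥ X H_c`, `Ĥ Ĝ Ĥ = Ĥ`, and the dual band `‖B y‖ ≤ 200/189 ‖y‖`);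
* consequently for the pair forms of a class: `pair(c, Ĥ) = pair(c, H_c − H_c X H_c) + pair(c, PSD)` with
  `0 ≤ pair(c, PSD) ≤ (200/189)² · pair(c, (X H_c)ᵀ M₀⁻¹ (X H_c))`.

So every `Ĥ`-dependent term of the near form is a POLYNOMIAL in the strain variables (through `X`) plus a signed
remainder that is itself a polynomial pair form of degree two in `X`: no chart variables for `Ĥ` are needed.
Pure linear algebra in `ℝ³`. [folklore]
-/

noncomputable section

open scoped BigOperators Classical InnerProductSpace Matrix
open Filter Set Function
open Summit.AtomisticToContinuum.Crystallization.Theorems.PhononStabilityNegative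

namespace Summit.AtomisticToContinuum.Crystallization.Theorems.PhononStabilityCWC.Cert

local notation "E3" => EuclideanSpace ℝ (Fin 3)
local notation "M3" => Matrix (Fin 3) (Fin 3) ℝ

/-! ## The chart matrices as `Matrix` objects -/

/-- `Ĝ` as a matrix. -/
def gMat (A : E3 →L[ℝ] E3) : M3 := Matrix.of fun i j => ghat A i j
/-- `Ĥ` as a matrix. -/
def hMat (B : E3 →L[ℝ] E3) : M3 := Matrix.of fun i j => hhat B i j
/-- a rational matrix as a real matrix. -/
def castMat (Q : Mat) : M3 := Matrix.of fun i j => (Q i j : ℝ)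

/-- entries of `gMat`. [folklore] -/
@[simp] theorem gMat_apply (A : E3 →L[ℝ] E3) (i j : Fin 3) : gMat A i j = ghat A i j := rfl
/-- entries of `hMat`. [folklore] -/
@[simp] theorem hMat_apply (B : E3 →L[ℝ] E3) (i j : Fin 3) : hMat B i j = hhat B i j := rfl
/-- entries of `castMat`. [folklore] -/
@[simp] theorem castMat_apply (Q : Mat) (i j : Fin 3) : castMat Q i j = (Q i j : ℝ) := rfl

/-- the link `Ĝ Ĥ = 1`. [folklore] -/
theorem gMat_mul_hMat {A B : E3 →L[ℝ] E3} (hAB : Contragredient A B) : gMat A * hMat B = 1 := by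
  ext i j
  rw [Matrix.mul_apply, Matrix.one_apply]
  simpa [gMat, hMat] using stub_certLinks A B hAB i j

/-- `Ĝ` is symmetric. [folklore] -/
theorem gMat_transpose (A : E3 →L[ℝ] E3) : (gMat A)ᵀ = gMat A := by
  ext i j; simp [gMat, ghat_symm A j i]

/-- `Ĥ` is symmetric. [folklore] -/
theorem hMat_transpose (B : E3 →L[ℝ] E3) : (hMat B)ᵀ = hMat B := by
  ext i j; simp [hMat, hhat_symm B j i]

/-- the link `Ĥ Ĝ = 1` (transpose of `Ĝ Ĥ = 1`). [folklore] -/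
theorem hMat_mul_gMat {A B : E3 →L[ℝ] E3} (hAB : Contragredient A B) : hMat B * gMat A = 1 := by
  have h := congrArg Matrix.transpose (gMat_mul_hMat hAB)
  rwa [Matrix.transpose_mul, gMat_transpose, hMat_transpose, Matrix.transpose_one] at h

/-! ## The elimination identity -/

/-- `Ĥ − H_c = −Ĥ X H_c` for `X = Ĝ − G_c`, `G_c H_c = 1`. [folklore] -/
theorem hMat_sub_eq {A B : E3 →L[ℝ] E3} (hAB : Contragredient A B) (Gc Hc : M3) (h1 : Gc * Hc = 1) :
    hMat B - Hc = -(hMat B * (gMat A - Gc) * Hc) := by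
  have hHG : hMat B * gMat A = 1 := hMat_mul_gMat hAB
  rw [Matrix.mul_sub, Matrix.sub_mul, hHG, Matrix.one_mul, Matrix.mul_assoc (hMat B) Gc Hc, h1, Matrix.mul_one]
  abel

/-- **`Ĥ = H_c − H_c X H_c + (Ĥ − H_c) Ĝ (Ĥ − H_c)`** for `G_c H_c = 1 = H_c G_c`, `X = Ĝ − G_c`. [folklore] -/
theorem hMat_eq {A B : E3 →L[ℝ] E3} (hAB : Contragredient A B) (Gc Hc : M3) (h2 : Hc * Gc = 1) :
    hMat B = Hc - Hc * (gMat A - Gc) * Hc + (hMat B - Hc) * gMat A * (hMat B - Hc) := by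
  set G := gMat A
  set H := hMat B
  have hGH : G * H = 1 := gMat_mul_hMat hAB
  have hHG : H * G = 1 := hMat_mul_gMat hAB
  have e1 : H * G * H = H := by rw [hHG, Matrix.one_mul]
  have e2 : H * G * Hc = Hc := by rw [hHG, Matrix.one_mul]
  have e3 : Hc * G * H = Hc := by rw [Matrix.mul_assoc, hGH, Matrix.mul_one]
  have e5 : Hc * Gc * Hc = Hc := by rw [h2, Matrix.one_mul]
  have expand : (H - Hc) * G * (H - Hc) = H * G * H - H * G * Hc - Hc * G * H + Hc * G * Hc := by
    simp only [Matrix.sub_mul, Matrix.mul_sub]; abel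
  have expand2 : Hc * (G - Gc) * Hc = Hc * G * Hc - Hc * Gc * Hc := by
    simp only [Matrix.sub_mul, Matrix.mul_sub]
  rw [expand, e1, e2, e3, expand2, e5]
  abel

/-! ## Quadratic forms of the chart matrices -/

/-- `bilR M x x` is the quadratic form `x ⬝ᵥ M x`. [folklore] -/
theorem bilR_eq_dotProduct (M : M3) (x : Fin 3 → ℝ) : bilR M x x = x ⬝ᵥ (M *ᵥ x) := by
  simp only [bilR, dotProduct, Matrix.mulVec, Finset.mul_sum]
  refine Finset.sum_congr rfl fun i _ => Finset.sum_congr rfl fun j _ => ?_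
  ring

/-- `yᵀ Ĝ y = ‖A (Σ yₖ genₖ)‖² ≥ 0`. [folklore] -/
theorem dotProduct_gMat_nonneg (A : E3 →L[ℝ] E3) (y : Fin 3 → ℝ) : 0 ≤ y ⬝ᵥ (gMat A *ᵥ y) := by
  have h := norm_sq_chart A y
  have : y ⬝ᵥ (gMat A *ᵥ y) = ∑ i, ∑ j, y i * ghat A i j * y j := by
    simp only [dotProduct, Matrix.mulVec, gMat, Matrix.of_apply, Finset.mul_sum]
    refine Finset.sum_congr rfl fun i _ => Finset.sum_congr rfl fun j _ => ?_
    ring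
  rw [this, ← h]
  positivity

/-- `zᵀ Ĥ z = ‖B (Σ zₖ dgenₖ)‖²`. [folklore] -/
theorem dotProduct_hMat_eq (B : E3 →L[ℝ] E3) (z : Fin 3 → ℝ) :
    z ⬝ᵥ (hMat B *ᵥ z) = ‖B (∑ k, z k • dgen k)‖ ^ 2 := by
  have hx : covOf (∑ k, z k • dgen k) = z := by
    funext i
    simp only [covOf, inner_sum, real_inner_smul_right, inner_gen_dgen]
    simp
  rw [norm_sq_metric_chart, hx, bilR_eq_dotProduct]
  rfl

/-- `zᵀ M₀⁻¹ z = ‖Σ zₖ dgenₖ‖²`. [folklore] -/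
theorem dotProduct_m0_eq (z : Fin 3 → ℝ) :
    z ⬝ᵥ (castMat M0inv *ᵥ z) = ‖∑ k, z k • dgen k‖ ^ 2 := by
  have hx : covOf (∑ k, z k • dgen k) = z := by
    funext i
    simp only [covOf, inner_sum, real_inner_smul_right, inner_gen_dgen]
    simp
  rw [norm_sq_plain_chart, hx, bilR_eq_dotProduct]
  rfl

/-- for a symmetric `S`, `xᵀ (S Ĝ S) x = (S x)ᵀ Ĝ (S x)`. [folklore] -/
theorem dotProduct_sandwich {S : M3} (hS : Sᵀ = S) (G : M3) (x : Fin 3 → ℝ) :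
    x ⬝ᵥ ((S * G * S) *ᵥ x) = (S *ᵥ x) ⬝ᵥ (G *ᵥ (S *ᵥ x)) := by
  rw [← Matrix.mulVec_mulVec, ← Matrix.mulVec_mulVec, Matrix.dotProduct_mulVec, ← Matrix.mulVec_transpose, hS]

/-- **positivity of the PSD part:** `0 ≤ xᵀ (Ĥ − H_c) Ĝ (Ĥ − H_c) x` for symmetric `H_c`. [folklore] -/
theorem psdPart_nonneg {A B : E3 →L[ℝ] E3} {Hc : M3} (hHc : Hcᵀ = Hc) (x : Fin 3 → ℝ) :
    0 ≤ x ⬝ᵥ (((hMat B - Hc) * gMat A * (hMat B - Hc)) *ᵥ x) := by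
  have hS : (hMat B - Hc)ᵀ = hMat B - Hc := by rw [Matrix.transpose_sub, hMat_transpose, hHc]
  rw [dotProduct_sandwich hS]
  exact dotProduct_gMat_nonneg A _

/-- **window bound of the PSD part:** `xᵀ (Ĥ − H_c) Ĝ (Ĥ − H_c) x ≤ (200/189)² · zᵀ M₀⁻¹ z`, `z = (X H_c) x`,
on the cell window. [folklore] -/
theorem psdPart_le {A B : E3 →L[ℝ] E3} (hW : CellWindow A) (hAB : Contragredient A B) {Gc Hc : M3}
    (h1 : Gc * Hc = 1) (hHc : Hcᵀ = Hc) (x : Fin 3 → ℝ) :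
    x ⬝ᵥ (((hMat B - Hc) * gMat A * (hMat B - Hc)) *ᵥ x) ≤
      (200 / 189) ^ 2 * ((((gMat A - Gc) * Hc) *ᵥ x) ⬝ᵥ (castMat M0inv *ᵥ (((gMat A - Gc) * Hc) *ᵥ x))) := by
  set G := gMat A
  set H := hMat B
  set X := G - Gc
  set z : Fin 3 → ℝ := (X * Hc) *ᵥ x
  have hS : (H - Hc)ᵀ = H - Hc := by rw [Matrix.transpose_sub, hMat_transpose, hHc]
  rw [dotProduct_sandwich hS]
  -- (H - Hc) x = -(H (X (Hc x))) = -(H z)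
  have hy : (H - Hc) *ᵥ x = -(H *ᵥ z) := by
    rw [hMat_sub_eq hAB Gc Hc h1, Matrix.neg_mulVec, Matrix.mul_assoc, ← Matrix.mulVec_mulVec]
  rw [hy, Matrix.mulVec_neg, dotProduct_neg, neg_dotProduct, neg_neg]
  -- (H z)ᵀ G (H z) = zᵀ (H G H) z = zᵀ H z
  have hHGH : ∀ y : Fin 3 → ℝ, (H *ᵥ y) ⬝ᵥ (G *ᵥ (H *ᵥ y)) = y ⬝ᵥ (H *ᵥ y) := by
    intro y
    rw [Matrix.mulVec_mulVec, gMat_mul_hMat hAB, Matrix.one_mulVec, dotProduct_comm]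
  rw [hHGH z, dotProduct_hMat_eq, dotProduct_m0_eq]
  have hb := stub_certDual A B hW hAB (∑ k, z k • dgen k)
  have h0 : 0 ≤ ‖B (∑ k, z k • dgen k)‖ := norm_nonneg _
  calc ‖B (∑ k, z k • dgen k)‖ ^ 2 ≤ (200 / 189 * ‖∑ k, z k • dgen k‖) ^ 2 := pow_le_pow_left₀ h0 hb 2
    _ = (200 / 189) ^ 2 * ‖∑ k, z k • dgen k‖ ^ 2 := by ring

/-! ## Pair-form consequences -/

/-- the PSD part as a function matrix -/
def psdMat (A B : E3 →L[ℝ] E3) (Hc : M3) : M3 := (hMat B - Hc) * gMat A * (hMat B - Hc)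

/-- the polynomial part `H_c − H_c X H_c` -/
def lowMat (A : E3 →L[ℝ] E3) (Gc Hc : M3) : M3 := Hc - Hc * (gMat A - Gc) * Hc

/-- the majorant `(X H_c)ᵀ M₀⁻¹ (X H_c)` of the PSD part -/
def majMat (A : E3 →L[ℝ] E3) (Gc Hc : M3) : M3 := ((gMat A - Gc) * Hc)ᵀ * castMat M0inv * ((gMat A - Gc) * Hc)

/-- **the metric pair form splits:** `pair(c, Ĥ) = pair(c, H_c − H_c X H_c) + pair(c, PSD)`. [folklore] -/
theorem pairEvalR_hhat_split {A B : E3 →L[ℝ] E3} (hAB : Contragredient A B) {Gc Hc : M3}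
    (h2 : Hc * Gc = 1) (c : BondClass) {w : Label → E3} (hw : (support w).Finite) :
    pairEvalR c (hhat B) w = pairEvalR c (lowMat A Gc Hc) w + pairEvalR c (psdMat A B Hc) w := by
  have h : (hhat B : Fin 3 → Fin 3 → ℝ) = fun i j => lowMat A Gc Hc i j + psdMat A B Hc i j := by
    funext i j
    have := congrFun (congrFun (hMat_eq hAB Gc Hc h2) i) j
    simpa [hMat, lowMat, psdMat, Matrix.add_apply] using this
  rw [h, pairEvalR_add hw]

/-- **positivity:** `0 ≤ pair(c, PSD)`. [folklore] -/
theorem pairEvalR_psd_nonneg (A B : E3 →L[ℝ] E3) {Hc : M3} (hHc : Hcᵀ = Hc) (c : BondClass) (w : Label → E3) :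
    0 ≤ pairEvalR c (psdMat A B Hc) w := by
  unfold pairEvalR
  refine tsum_nonneg fun k => ?_
  rw [bilR_eq_dotProduct]
  exact psdPart_nonneg hHc _

/-- **window bound:** `pair(c, PSD) ≤ (200/189)² · pair(c, (X H_c)ᵀ M₀⁻¹ (X H_c))` on the cell window. [folklore] -/
theorem pairEvalR_psd_le {A B : E3 →L[ℝ] E3} (hW : CellWindow A) (hAB : Contragredient A B) {Gc Hc : M3}
    (h1 : Gc * Hc = 1) (hHc : Hcᵀ = Hc) (c : BondClass) {w : Label → E3} (hw : (support w).Finite) :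
    pairEvalR c (psdMat A B Hc) w ≤ (200 / 189) ^ 2 * pairEvalR c (majMat A Gc Hc) w := by
  unfold pairEvalR
  rw [← tsum_mul_left]
  refine Summable.tsum_le_tsum (fun k => ?_) (summable_pairR hw c _) ((summable_pairR hw c _).mul_left _)
  rw [bilR_eq_dotProduct, bilR_eq_dotProduct]
  have h := psdPart_le hW hAB h1 hHc (covDiff c w k)
  have hm : covDiff c w k ⬝ᵥ (majMat A Gc Hc *ᵥ covDiff c w k) =
      (((gMat A - Gc) * Hc) *ᵥ covDiff c w k) ⬝ᵥ (castMat M0inv *ᵥ (((gMat A - Gc) * Hc) *ᵥ covDiff c w k)) := by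
    unfold majMat
    rw [← Matrix.mulVec_mulVec, ← Matrix.mulVec_mulVec, Matrix.dotProduct_mulVec, Matrix.vecMul_transpose]
  rw [hm]
  exact h

/-- Anchor of this support file (registered stub of the line skeleton, lead c2). -/
theorem stub_certMetric : ∀ (A B : EuclideanSpace ℝ (Fin 3) →L[ℝ] EuclideanSpace ℝ (Fin 3)), Contragredient A B →
    ∀ i j : Fin 3, (∑ k, hhat B i k * ghat A k j) = if i = j then (1 : ℝ) else 0 :=
  by
  intro A B hAB i j
  have h := congrFun (congrFun (hMat_mul_gMat hAB) i) j
  rw [Matrix.mul_apply, Matrix.one_apply] at h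
  simpa [hMat, gMat] using h

end Summit.AtomisticToContinuum.Crystallization.Theorems.PhononStabilityCWC.Cert

end
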